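import Mathlib

/-!
# Monotone modulus of the recessive solution of an absorbing three-term recurrence
# (kernel #234, lemmaR-A3 §8(x), PLAN §115)

Solo-blind programme, session s92.  In regime (II) of LEMMA R⁺ the streak block of the
steady-door chain is, after the rotation `v ↦ i^{-m} v`, the second-order difference equation

  `v (k+2) - 2 v (k+1) + v k = c (k+1) · v (k+1)`,   `c k = g² Q_k = -2i (z' + ε K₀ k²)`,

truncated at `v (M+1) = 0` (finite section).  The Jost lemma [L1] of the v4 architecture
needs the NON-RESONANCE bound `N := max_k |v k / v 0| ≤ const`; the audit of s92 showed that
every m-side perturbative proof of [L1] is circular in `N`.  This file proves the half that is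
NOT circular: whenever the absorption has non-negative real part, `Re (c k) ≥ 0` (for the
streak block this is exactly `Re x ≥ 0` on the spectral strip), the modulus of the truncated
recessive solution is NON-INCREASING from the boundary inwards, so `N = 1`.  More precisely
the Riccati ratio `ρ_k = v (k+1) / v k` lies in the closed disc `|ρ - 1/2| ≤ 1/2`
(`|v (k+1)|² ≤ Re (conj (v k) · v (k+1))`).

The proof is the discrete energy (Abel) identity, stated here in LOCAL form so that no
`Finset` bookkeeping is needed:
`E k = E (k+1) + |v (k+1) - v k|² + c (k+1) |v (k+1)|²` with `E k := conj (v k) (v k - v (k+1))`,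
followed by a downward induction from `E M = |v M|² ≥ 0`.

Also recorded: the discrete Lagrange (Green) identity between two arbitrary sequences for the
same operator, in local (one-step telescoping) form — the exact identity behind the reduction
`[L1] ⟸ N bounded` of §8(x).
-/

namespace Summit.AnomalousDissipation.AnomalousDissipation.Theorems

open Complex

/-- The local energy of a sequence at site `k`: `E k = conj (v k) · (v k - v (k+1))`. -/
noncomputable def recEnergy (v : ℕ → ℂ) (k : ℕ) : ℂ :=
  (starRingEnd ℂ) (v k) * (v k - v (k + 1))

/-- `Re (conj a · b) + Re (conj b · a) = 2 Re (conj a · b)`, in coordinates. -/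
theorem re_conj_mul_symm (a b : ℂ) :
    ((starRingEnd ℂ) b * a).re = ((starRingEnd ℂ) a * b).re := by
  simp only [Complex.mul_re, Complex.conj_re, Complex.conj_im]
  ring

/-- `|b - a|² = |a|² + |b|² - 2 Re (conj a · b)`. -/
theorem normSq_sub_eq (a b : ℂ) :
    Complex.normSq (b - a) = Complex.normSq a + Complex.normSq b - 2 * ((starRingEnd ℂ) a * b).re := by
  simp only [Complex.normSq_apply, Complex.mul_re, Complex.conj_re, Complex.conj_im,
    Complex.sub_re, Complex.sub_im]
  ring

/-- LOCAL ENERGY IDENTITY.  If the row `v (k+2) - 2 v (k+1) + v k = c · v (k+1)` holds, then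
`Re E k = Re E (k+1) + |v (k+1) - v k|² + Re c · |v (k+1)|²`. -/
theorem recEnergy_step_re (v : ℕ → ℂ) (c : ℂ) (k : ℕ)
    (hrow : v (k + 2) - 2 * v (k + 1) + v k = c * v (k + 1)) :
    (recEnergy v k).re = (recEnergy v (k + 1)).re + Complex.normSq (v (k + 1) - v k)
      + c.re * Complex.normSq (v (k + 1)) := by
  have h2 : v (k + 2) = c * v (k + 1) + 2 * v (k + 1) - v k := by
    rw [← hrow]; ring
  unfold recEnergy
  rw [show k + 1 + 1 = k + 2 by ring, h2]
  simp only [Complex.normSq_apply, Complex.mul_re, Complex.mul_im, Complex.conj_re,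
    Complex.conj_im, Complex.sub_re, Complex.sub_im, Complex.add_re, Complex.add_im,
    Complex.re_ofNat, Complex.im_ofNat]
  ring

/-- DOWNWARD INDUCTION.  Rows for `k + 1 ≤ M`, truncation `v (M+1) = 0`, absorption with
non-negative real part ⇒ every local energy has non-negative real part. -/
theorem recEnergy_re_nonneg (v : ℕ → ℂ) (c : ℕ → ℂ) (M : ℕ)
    (hrow : ∀ k, k + 1 ≤ M → v (k + 2) - 2 * v (k + 1) + v k = c (k + 1) * v (k + 1))
    (hc : ∀ k, 0 ≤ (c k).re) (hM : v (M + 1) = 0) :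
    ∀ k, k ≤ M → 0 ≤ (recEnergy v k).re := by
  -- induction on the distance n = M - k to the truncation point
  have key : ∀ n k, k + n = M → 0 ≤ (recEnergy v k).re := by
    intro n
    induction n with
    | zero =>
      intro k hk
      simp only [Nat.add_zero] at hk
      subst hk
      unfold recEnergy
      rw [hM, sub_zero]
      simp only [Complex.mul_re, Complex.conj_re, Complex.conj_im]
      nlinarith [sq_nonneg (v k).re, sq_nonneg (v k).im]
    | succ n ih =>
      intro k hk
      have hk1 : k + 1 + n = M := by omega
      have hle : k + 1 ≤ M := by omega
      have h := recEnergy_step_re v (c (k + 1)) k (hrow k hle)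
      have h1 := ih (k + 1) hk1
      have h2 : 0 ≤ Complex.normSq (v (k + 1) - v k) := Complex.normSq_nonneg _
      have h3 : 0 ≤ (c (k + 1)).re * Complex.normSq (v (k + 1)) :=
        mul_nonneg (hc (k + 1)) (Complex.normSq_nonneg _)
      linarith
  intro k hk
  exact key (M - k) k (by omega)

/-- THE DISC PROPERTY of the Riccati ratio: under the same hypotheses,
`|v (k+1)|² ≤ Re (conj (v k) · v (k+1))` for every `k ≤ M`, i.e. `v (k+1) / v k` lies in the
closed disc of centre `1/2` and radius `1/2` whenever `v k ≠ 0`. -/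
theorem recessive_ratio_disc (v : ℕ → ℂ) (c : ℕ → ℂ) (M : ℕ)
    (hrow : ∀ k, k + 1 ≤ M → v (k + 2) - 2 * v (k + 1) + v k = c (k + 1) * v (k + 1))
    (hc : ∀ k, 0 ≤ (c k).re) (hM : v (M + 1) = 0) :
    ∀ k, k ≤ M → Complex.normSq (v (k + 1)) ≤ ((starRingEnd ℂ) (v k) * v (k + 1)).re := by
  intro k hk
  rcases Nat.lt_or_ge k M with hlt | hge
  · -- interior site: Re E k ≥ Re E (k+1) + |Δ|² ≥ |Δ|²
    have hle : k + 1 ≤ M := hlt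
    have h := recEnergy_step_re v (c (k + 1)) k (hrow k hle)
    have h1 := recEnergy_re_nonneg v c M hrow hc hM (k + 1) hle
    have h3 : 0 ≤ (c (k + 1)).re * Complex.normSq (v (k + 1)) :=
      mul_nonneg (hc (k + 1)) (Complex.normSq_nonneg _)
    have hE : Complex.normSq (v (k + 1) - v k) ≤ (recEnergy v k).re := by linarith
    have hd := normSq_sub_eq (v k) (v (k + 1))
    -- Re E k = |v k|² - Re(conj v k · v (k+1))
    have hEk : (recEnergy v k).re = Complex.normSq (v k) - ((starRingEnd ℂ) (v k) * v (k + 1)).re := by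
      unfold recEnergy
      simp only [Complex.normSq_apply, Complex.mul_re, Complex.conj_re, Complex.conj_im,
        Complex.sub_re, Complex.sub_im]
      ring
    linarith
  · -- boundary site k = M: v (M+1) = 0
    have hkM : k = M := le_antisymm hk hge
    subst hkM
    rw [hM]
    simp

/-- MONOTONE MODULUS (non-resonance with constant `N = 1`): under the same hypotheses
`|v (k+1)|² ≤ |v k|²` for every `k ≤ M`. -/
theorem recessive_normSq_antitone (v : ℕ → ℂ) (c : ℕ → ℂ) (M : ℕ)
    (hrow : ∀ k, k + 1 ≤ M → v (k + 2) - 2 * v (k + 1) + v k = c (k + 1) * v (k + 1))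
    (hc : ∀ k, 0 ≤ (c k).re) (hM : v (M + 1) = 0) :
    ∀ k, k ≤ M → Complex.normSq (v (k + 1)) ≤ Complex.normSq (v k) := by
  intro k hk
  have hd := recessive_ratio_disc v c M hrow hc hM k hk
  -- Re(conj a · b) ≤ |a| |b| and |b|² ≤ |a||b| ⇒ |b| ≤ |a|
  have hcs : ((starRingEnd ℂ) (v k) * v (k + 1)).re ≤ ‖v k‖ * ‖v (k + 1)‖ := by
    have := Complex.re_le_norm ((starRingEnd ℂ) (v k) * v (k + 1))
    rwa [norm_mul, Complex.norm_conj] at this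
  rw [Complex.normSq_eq_norm_sq, Complex.normSq_eq_norm_sq] at *
  have ha : 0 ≤ ‖v k‖ := norm_nonneg _
  have hb : 0 ≤ ‖v (k + 1)‖ := norm_nonneg _
  nlinarith [hd, hcs, ha, hb, sq_nonneg (‖v k‖ - ‖v (k + 1)‖)]

/-- Corollary: the truncated recessive solution is dominated by its first entry,
`|v k| ≤ |v 0|` for all `k ≤ M + 1` (the non-resonance constant is `1`). -/
theorem recessive_norm_le_head (v : ℕ → ℂ) (c : ℕ → ℂ) (M : ℕ)
    (hrow : ∀ k, k + 1 ≤ M → v (k + 2) - 2 * v (k + 1) + v k = c (k + 1) * v (k + 1))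
    (hc : ∀ k, 0 ≤ (c k).re) (hM : v (M + 1) = 0) :
    ∀ k, k ≤ M + 1 → ‖v k‖ ≤ ‖v 0‖ := by
  have step : ∀ k, k ≤ M → ‖v (k + 1)‖ ≤ ‖v k‖ := by
    intro k hk
    have h := recessive_normSq_antitone v c M hrow hc hM k hk
    rw [Complex.normSq_eq_norm_sq, Complex.normSq_eq_norm_sq] at h
    by_contra hlt
    push Not at hlt
    nlinarith [norm_nonneg (v k), norm_nonneg (v (k + 1)), h, hlt]
  intro k
  induction k with
  | zero => intro _; exact le_refl _
  | succ k ih =>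
    intro hk
    exact le_trans (step k (by omega)) (ih (by omega))

/-- DISCRETE LAGRANGE (GREEN) IDENTITY, local form.  For the operator
`(L f) k = f (k+1) - 2 f k + f (k-1) - c f k` (written at the site `k+1` to avoid natural
subtraction) and any two sequences `u w`, the absorption cancels and
`u (L w) - w (L u)` is an exact difference of the Casoratian `C k = u k · w (k+1) - w k · u (k+1)`. -/
theorem lagrange_identity_local (u w : ℕ → ℂ) (c : ℂ) (k : ℕ) :
    u (k + 1) * (w (k + 2) - 2 * w (k + 1) + w k - c * w (k + 1))
      - w (k + 1) * (u (k + 2) - 2 * u (k + 1) + u k - c * u (k + 1))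
    = (u (k + 1) * w (k + 2) - w (k + 1) * u (k + 2)) - (u k * w (k + 1) - w k * u (k + 1)) := by
  ring

/-- Summed Lagrange identity: `Σ_{k<M} [u (L w) - w (L u)]_{k+1} = C M - C 0`. -/
theorem lagrange_identity_sum (u w : ℕ → ℂ) (c : ℕ → ℂ) (M : ℕ) :
    (Finset.range M).sum (fun k =>
      u (k + 1) * (w (k + 2) - 2 * w (k + 1) + w k - c (k + 1) * w (k + 1))
        - w (k + 1) * (u (k + 2) - 2 * u (k + 1) + u k - c (k + 1) * u (k + 1)))
    = (u M * w (M + 1) - w M * u (M + 1)) - (u 0 * w 1 - w 0 * u 1) := by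
  have h := Finset.sum_range_sub (fun k => u k * w (k + 1) - w k * u (k + 1)) M
  rw [← h]
  apply Finset.sum_congr rfl
  intro k _
  rw [← lagrange_identity_local u w (c (k + 1)) k]

/-- If `u` solves the homogeneous rows and `w` has defects `τ`, `(L w)_{k+1} = τ (k+1)`, the
summed identity reads `Σ_{k<M} u (k+1) τ (k+1) = C M - C 0`: the exact representation of the
Jost-data difference used in §8(x) (`[L1] ⟸ N bounded`). -/
theorem defect_representation (u w : ℕ → ℂ) (c τ : ℕ → ℂ) (M : ℕ)
    (hu : ∀ k, k + 1 ≤ M → u (k + 2) - 2 * u (k + 1) + u k - c (k + 1) * u (k + 1) = 0)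
    (hw : ∀ k, k + 1 ≤ M → w (k + 2) - 2 * w (k + 1) + w k - c (k + 1) * w (k + 1) = τ (k + 1)) :
    (Finset.range M).sum (fun k => u (k + 1) * τ (k + 1))
    = (u M * w (M + 1) - w M * u (M + 1)) - (u 0 * w 1 - w 0 * u 1) := by
  rw [← lagrange_identity_sum u w c M]
  apply Finset.sum_congr rfl
  intro k hk
  have hk' : k + 1 ≤ M := by
    have := Finset.mem_range.mp hk; omega
  rw [hu k hk', hw k hk']
  ring

end Summit.AnomalousDissipation.AnomalousDissipation.Theorems
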